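import Summits.QuantumFields.YangMills.Theorems.LuscherReductionTwistedTraceScalingBTGaussianProfile
import Summits.QuantumFields.YangMills.Theorems.LuscherReductionTwistedTraceScalingRecordWeight
import Summits.QuantumFields.YangMills.Theorems.LuscherReductionTwistedTraceScalingChartTransport
import HarnessLib

/-!
# (B-ST) FLAT COORDINATES of the balanced fibre adapted to the profile (route-posited definitions for the flat model of `hflat`)
# (lane A of S-BASE, crux `TwistedTraceScaling` stmt-QuantumFields-20203, C4-CORE, the (B-ST) pen; `pub/ym-fleet/ym-luscher-20007-p1/HANDOFF-g22.md` §PLAN TO CLOSE hflat (1))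

The flat Poincaré inequality of hand w3 (✓`…BOStiffFlatPoincare.flat_poincare_betaFree`: Mehler in coordinates `y : σ → ℝ` ⊗ resampling on `Z`) is pulled back to the
fibre along a linear parametrisation of the balanced subspace ADAPTED TO THE PROFILE `cΘ = e^{−‖P_Γ x̂‖²β²}·e^{−q_β(x̂)}`: the stiff directions are read in the
eigenframe `(E_i, α_i)` of `(β/2)·stiffHessian L` — the SAME frame `stiffGaussExp L (β/2) β` is defined with — rescaled mode by mode so that the Mehler data are in the
normalisation `ã² + 2ãb̃ = π²` of ✓`…MehlerPoincare`; the gauge directions are the submodule `gaugeModes L` itself.  This file only NAMES the objects: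
`eigVal β i`, `eigVec β i` (the frame), `stiffCoef β i = √(α_i² + 2α_iβ)` (so `q_β = Σ stiffCoef·⟪E_i,·⟫²`), the stiff index type `StiffIdx β = {i // α_i ≠ 0}`, the scale
`flatScale β i = √(π/stiffCoef β i)`, the Mehler data `flatA β i = α_i·flatScale²`, `flatB β i = β·flatScale²`, and the linear parametrisation
★ `flatVec β : (StiffIdx β → ℝ) × gaugeModes L →ₗ LinkSpace L`, `(y, z) ↦ Σ_i flatScale β i·y_i·E_i + z`, `flatMap β = linkCurry ∘ flatVec β` (values in `Edge → ℝ³`).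
The dictionary (`q_β(flatVec(y,z)) = πΣy_i²`, `‖P_Γ·‖ = ‖z‖`, range `= balancedSet`, …) is the next file `…BOStiffFlatCoords`.
HONEST FRAMING: definitions for a stub of a child of the CONDITIONAL route R2b1; (B-ST) OPEN; C4-CORE OPEN; not infinite volume, not a gap, not Clay.
-/

set_option autoImplicit false

noncomputable section

open scoped BigOperators RealInnerProductSpace
open Literature.MathematicalPhysics.QuantumFieldTheory Literature.MathematicalPhysics.QuantumLattice

namespace Summit.QuantumFields.YangMills.Theorems.FemtoTransferGap.TwoLattice.ConstTube

open TwoLattice.Stiff TwoLattice.Cov TwoLattice.GnChart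

variable (L : ℕ) [NeZero L]

/-- The eigenvalues `α_i` of `(β/2)·stiffHessian L` in the frame of `stiffGaussExp L (β/2) β`. [cite: Wipf2021, §8.5.2] -/
def eigVal (β : ℝ) (i : Fin (Fintype.card (Edge 3 L × Fin 3))) : ℝ :=
  (isSymmetric_smul_stiffHessian (L := L) (β / 2)).eigenvalues finrank_euclideanSpace i

/-- The eigenvectors `E_i` of `(β/2)·stiffHessian L` (an orthonormal basis of `LinkSpace L`) in the frame of `stiffGaussExp L (β/2) β`. [cite: Wipf2021, §8.5.2] -/
def eigVec (β : ℝ) (i : Fin (Fintype.card (Edge 3 L × Fin 3))) : LinkSpace L :=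
  (isSymmetric_smul_stiffHessian (L := L) (β / 2)).eigenvectorBasis finrank_euclideanSpace i

/-- The profile coefficients `c_i = √(α_i² + 2α_iβ)` (`q_β = Σ_i c_i⟪E_i,·⟫²`). [cite: Wipf2021, §8.5.2 (8.64)–(8.67)] -/
def stiffCoef (β : ℝ) (i : Fin (Fintype.card (Edge 3 L × Fin 3))) : ℝ := Real.sqrt (eigVal L β i ^ 2 + 2 * eigVal L β i * β)

/-- The STIFF indices: the modes with `α_i ≠ 0` (the others span `ker H = constModes ⊔ gaugeModes`). [folklore] -/
def StiffIdx (β : ℝ) : Type := {i : Fin (Fintype.card (Edge 3 L × Fin 3)) // eigVal L β i ≠ 0}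

/-- The stiff index type is finite (a subtype of `Fin n`; classical decidability of `α_i ≠ 0`). [folklore] -/
instance instFintypeStiffIdx (β : ℝ) : Fintype (StiffIdx L β) := by unfold StiffIdx; classical exact inferInstance

/-- The stiff index type has decidable equality (a subtype of `Fin n`). [folklore] -/
instance instDecidableEqStiffIdx (β : ℝ) : DecidableEq (StiffIdx L β) := by unfold StiffIdx; classical exact inferInstance

/-- The mode-by-mode scale `γ_i = √(π/c_i)` putting the stiff Mehler data in the normalisation `ã² + 2ãb̃ = π²`. [folklore] -/
def flatScale (β : ℝ) (i : StiffIdx L β) : ℝ := Real.sqrt (Real.pi / stiffCoef L β i.1)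

/-- The rescaled magnetic Mehler datum `ã_i = α_i·γ_i²`. [folklore] -/
def flatA (β : ℝ) (i : StiffIdx L β) : ℝ := eigVal L β i.1 * flatScale L β i ^ 2

/-- The rescaled kinetic Mehler datum `b̃_i = β·γ_i²`. [folklore] -/
def flatB (β : ℝ) (i : StiffIdx L β) : ℝ := β * flatScale L β i ^ 2

/-- ★ **The flat parametrisation** of the balanced fibre in `LinkSpace L`: `(y, z) ↦ Σ_i γ_i·y_i·E_i + z` (`z` a gauge mode). [folklore] -/
def flatVec (β : ℝ) : ((StiffIdx L β → ℝ) × gaugeModes L) →ₗ[ℝ] LinkSpace L where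
  toFun p := (∑ i : StiffIdx L β, (flatScale L β i * p.1 i) • eigVec L β i.1) + (p.2 : LinkSpace L)
  map_add' p q := by
    simp only [Prod.fst_add, Prod.snd_add, Pi.add_apply, Submodule.coe_add, mul_add, add_smul, Finset.sum_add_distrib]
    abel
  map_smul' r p := by
    simp only [Prod.smul_fst, Prod.smul_snd, Pi.smul_apply, smul_eq_mul, Submodule.coe_smul, RingHom.id_apply, smul_add, Finset.smul_sum, smul_smul]
    congr 1
    refine Finset.sum_congr rfl fun i _ => ?_
    ring_nf

/-- ★ **The flat parametrisation** with values in link coordinates `Edge → ℝ³`: `flatMap β = linkCurry ∘ flatVec β`. [folklore] -/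
def flatMap (β : ℝ) : ((StiffIdx L β → ℝ) × gaugeModes L) →ₗ[ℝ] (Edge 3 L → Fin 3 → ℝ) where
  toFun p := linkCurry (flatVec L β p)
  map_add' p q := by funext e a; simp [linkCurry, map_add]
  map_smul' r p := by funext e a; simp [linkCurry, map_smul]

end Summit.QuantumFields.YangMills.Theorems.FemtoTransferGap.TwoLattice.ConstTube

end
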